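import Literature.Probability.LatticeModels.KCObservableL2Bound
import Literature.Probability.LatticeModels.HarmonicBulkSup
import Literature.Probability.LatticeModels.HarmonicBulkLipschitz
import HarnessLib

/-!
# Sup and Lipschitz bounds for the critical spin fermion in the seam-free bulk

Topic `Literature/Probability/LatticeModels`. Chelkak–Hongler–Izyurov 2015, Thm 3.12 (after
Chelkak–Smirnov 2012, Thm 3.12): spinor observables with uniformly bounded primitives are
precompact, the limits being holomorphic. Lattice form for the signed critical Kadanoff–Ceva
observable `kcObs` (`IsingDisorderObservable.lean`), assembling `KCObservableL2Bound.lean` (bulk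
`L²` bound from `|H| ≤ M`), `HarmonicBulkSup.lean` (`L²` ⇒ sup for bond functions s-holomorphic in
the bulk) and `HarmonicBulkLipschitz.lean` (sup ⇒ Lipschitz):

* `KCBulk`: the bulk hypotheses on a finite set of sites (free sites off the background set with
  their four bonds in the domain graph; plaquettes of the cut system with touching sides and odd cut
  parity; and the seam-freeness `hLowSign = vLowSign` at the lower corners — away from the seam of
  the section, or after re-signing the section on one side of it);
* `KCBulk.isSHolAt_kcObs`: there `kcObs` is s-holomorphic at the four corners of every site whose
  west and south neighbours are also in the set;
* **`norm_kcObs_le_of_bulk`** (sup bound `‖F(e)‖ ≤ C(M)/√p` on the ball of radius `p`, `m = 4p`)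
  and **`norm_sub_kcObs_le_of_bulk`** (Lipschitz bound `‖F(x+e_j,·) - F(x,·)‖ ≤ C'(M)/(q√q)`,
  `m = 8q`), given `|Hw|, |Hb| ≤ M` on the ball of radius `4m + 1` for a Kadanoff–Ceva primitive.

In the scaling `δ → 0` with `p ≍ dist/δ` these are the uniform boundedness and equicontinuity of
`δ^{-1/2} F_δ` on compacts (CHI 2015, (3.12)–(3.13)), i.e. the input of
`ScalingLimitCompactness.lean`. Everything is proved; no named fact.

## References

* D. Chelkak, C. Hongler, K. Izyurov, Ann. of Math. 181 (2015): Thm 3.12 [ChelkakHonglerIzyurovAnnals2015].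
* S. Smirnov, Ann. of Math. 172 (2010): §5 [Smirnov2010].
-/

noncomputable section

namespace Literature.Probability.LatticeModels

open Finset Real SimpleGraph

variable (G₂ : SimpleGraph (Site 2)) [G₂.LocallyFinite]

/-- **Bulk hypotheses** for the spin fermion on a finite set `S` of sites: free sites off the
background set whose four bonds are their edge boundary in the domain graph, plaquettes in the cut
system with touching sides and odd cut parity, and agreement of the two sign conventions at the
lower corners (no seam in `S`). [cite: ChelkakHonglerIzyurovAnnals2015, §3.3] -/
structure KCBulk (Λ : Finset (Site 2)) (B : Finset (Site 2)) (cut : Site 2 → Finset (Sym2 (Site 2))) (P : Set (Site 2))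
    (S : Finset (Site 2)) : Prop where
  mem : ∀ x ∈ S, x ∈ Λ
  notMem : ∀ x ∈ S, x ∉ B
  bd : ∀ x ∈ S, edgeBoundary G₂ {x} = Finset.univ.image fun k : Fin 4 => cSrc (x, k)
  faces : ∀ x ∈ S, ∀ k : Fin 4, faceAt x k ∈ P
  sides : ∀ f ∈ S, ∀ j : Fin 4, s(f + cornerOff j, f + cornerOff j + cornerUnit j) ∈ edgesTouching G₂ Λ
  odd : ∀ f ∈ S, Odd #(Finset.univ.filter fun j : Fin 4 => s(f + cornerOff j, f + cornerOff j + cornerUnit j) ∈ cut f)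
  seam₂ : ∀ y ∈ S, hLowSign B (y + cornerUnit 2) = vLowSign B cut (y + cornerUnit 3)
  seam₃ : ∀ y ∈ S, vLowSign B cut (y + cornerUnit 3) = hLowSign B y

variable {G₂}
variable {Λ : Finset (Site 2)} {η : SpinConfig (Site 2)} {B : Finset (Site 2)} {cut : Site 2 → Finset (Sym2 (Site 2))}
  {P : Set (Site 2)}

/-- Restriction of the bulk hypotheses to a subset. [folklore] -/
theorem KCBulk.mono {S S' : Finset (Site 2)} (h : KCBulk G₂ Λ B cut P S) (hS : S' ⊆ S) : KCBulk G₂ Λ B cut P S' :=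
  ⟨fun x hx => h.mem x (hS hx), fun x hx => h.notMem x (hS hx), fun x hx => h.bd x (hS hx), fun x hx => h.faces x (hS hx),
    fun f hf => h.sides f (hS hf), fun f hf => h.odd f (hS hf), fun y hy => h.seam₂ y (hS hy), fun y hy => h.seam₃ y (hS hy)⟩

/-- **In the seam-free bulk the spin fermion is s-holomorphic at the four corners of a site** whose
west and south neighbours are bulk sites too. [cite: ChelkakHonglerIzyurovAnnals2015, Prop. 2.4] -/
theorem KCBulk.isSHolAt_kcObs {S : Finset (Site 2)} (h : KCBulk G₂ Λ B cut P S) (hc : IsKCCuts G₂ Λ cut P)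
    (hG : ∀ v ∈ Λ, ∀ k : Fin 4, G₂.Adj v (v + cornerUnit k)) (hle : G₂ ≤ zdGraph 2)
    {y : Site 2} (hy : y ∈ S) (hyW : y + cornerUnit 2 ∈ S) (hyS : y + cornerUnit 3 ∈ S) (k : Fin 4) :
    IsSHolAt (kcObs G₂ Λ η B cut) (y, k) := by
  obtain ⟨w0, wf0, wf3, -⟩ := westSite_facts y
  obtain ⟨s0, sf1, sf0, -⟩ := southSite_facts y
  have hP := h.faces y hy
  fin_cases k
  · obtain ⟨he, hstep⟩ := hc.step_gaugeEquiv G₂ (h.mem y hy) 1 (hP 1) (by rw [show (1 : Fin 4) + 3 = 0 from rfl]; exact hP 0)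
    rw [show (1 : Fin 4) + 3 = 0 from rfl] at hstep
    exact isSHolAt_kcObs_zero G₂ hG hle (hc.subset _ (hP 1)) he hstep
  · have h1 : faceAt (y + cornerUnit 2) 0 ∈ P := by rw [wf0]; exact hP 1
    have h2 : faceAt (y + cornerUnit 2) (0 + 3) ∈ P := by rw [show (0 : Fin 4) + 3 = 3 from rfl, wf3]; exact hP 2
    obtain ⟨he, hstep⟩ := hc.step_gaugeEquiv G₂ (h.mem _ hyW) 0 h1 h2
    rw [show (0 : Fin 4) + 3 = 3 from rfl, wf0, wf3] at hstep
    simp only [cSrc] at he hstep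
    exact isSHolAt_kcObs_one G₂ hG hle (hc.subset _ (hP 1)) he hstep
  · have h1 : faceAt (y + cornerUnit 3) 1 ∈ P := by rw [sf1]; exact hP 2
    have h2 : faceAt (y + cornerUnit 3) (1 + 3) ∈ P := by rw [show (1 : Fin 4) + 3 = 0 from rfl, sf0]; exact hP 3
    obtain ⟨he, hstep⟩ := hc.step_gaugeEquiv G₂ (h.mem _ hyS) 1 h1 h2
    rw [show (1 : Fin 4) + 3 = 0 from rfl, sf1, sf0] at hstep
    simp only [cSrc] at he hstep
    exact isSHolAt_kcObs_two G₂ hG hle (hc.subset _ (hP 2)) he hstep (h.seam₂ y hy)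
  · obtain ⟨he, hstep⟩ := hc.step_gaugeEquiv G₂ (h.mem y hy) 0 (hP 0) (by rw [show (0 : Fin 4) + 3 = 3 from rfl]; exact hP 3)
    rw [show (0 : Fin 4) + 3 = 3 from rfl] at hstep
    exact isSHolAt_kcObs_three G₂ hG hle (hc.subset _ (hP 0)) he hstep (h.seam₃ y hy)

/-- The constant of the sup bound for height `M`. [folklore] -/
def kcSupConst (M : ℝ) : ℝ := 96 * geomConst * Real.sqrt (4 * (4 * Real.sqrt 2 * kcFluxConst * M * energyGradConst))

/-- `kcSupConst M ≥ 0`. [folklore] -/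
theorem kcSupConst_nonneg (M : ℝ) : 0 ≤ kcSupConst M := by
  unfold kcSupConst
  have := geomConst_pos
  positivity

/-- **Sup bound for the spin fermion in the bulk**: with `m = 4p`, `p ≥ 8`, if the ball of radius
`4m + 3` about the centre of the box of side `4m` at `a` is seam-free bulk and `|Hw|, |Hb| ≤ M` on
the ball of radius `4m + 1` for a Kadanoff–Ceva primitive, then `‖F(e)‖ ≤ C(M)/√p` for the
horizontal and vertical edges at the sites of the ball of radius `p`. [cite: ChelkakHonglerIzyurovAnnals2015, Thm 3.12 (uniform boundedness (3.12))] -/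
theorem norm_kcObs_le_of_bulk {Hw Hb : Site 2 → ℝ} (h : IsKCPrimitive G₂ Λ criticalBetaTwo (.fixed η) B cut Hw Hb P)
    (hc : IsKCCuts G₂ Λ cut P) (hG : ∀ v ∈ Λ, ∀ k : Fin 4, G₂.Adj v (v + cornerUnit k)) (hle : G₂ ≤ zdGraph 2)
    {a : Site 2} {p : ℕ} (hp : 8 ≤ p)
    (hbulk : KCBulk G₂ Λ B cut P (latticeBall (boxCentre a (4 * p)) (2 * (2 * (4 * p)) + 3)))
    {M : ℝ} (hM : 0 < M)
    (hHw : ∀ x ∈ latticeBall (boxCentre a (4 * p)) (2 * (2 * (4 * p)) + 1), |Hw x| ≤ M)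
    (hHb : ∀ x ∈ latticeBall (boxCentre a (4 * p)) (2 * (2 * (4 * p)) + 1), |Hb x| ≤ M)
    {x : Site 2} (hx : x ∈ latticeBall (boxCentre a (4 * p)) p) {i : Fin 4} (hi : i = 0 ∨ i = 1) :
    ‖kcObs G₂ Λ η B cut (cSrc (x, i))‖ ≤ kcSupConst M / Real.sqrt p := by
  set m := 4 * p with hm
  set c := boxCentre a m with hc0
  have hm4 : 4 ≤ m := by omega
  have hsub : ∀ {R R' : ℤ}, R ≤ R' → ∀ y ∈ latticeBall c R, y ∈ latticeBall c R' :=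
    fun hRR' y hy => latticeBall_subset hRR' hy
  -- the `L²` bound on the ball of radius `m`
  have hL2 := sum_norm_sq_kcObs_le G₂ h hc hG hle hm4 hbulk.mem hbulk.notMem hbulk.bd hbulk.faces hbulk.sides hbulk.odd hM hHw hHb
  -- s-holomorphicity at all corners of the sites of the ball of radius `4m + 2`
  have hS : ∀ y ∈ latticeBall c (2 * (2 * m) + 2), ∀ k : Fin 4, IsSHolAt (kcObs G₂ Λ η B cut) (y, k) := by
    intro y hy k
    exact hbulk.isSHolAt_kcObs hc hG hle (hsub (by omega) y hy) (hsub (by omega) _ (add_cornerUnit_mem_latticeBall hy 2))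
      (hsub (by omega) _ (add_cornerUnit_mem_latticeBall hy 3)) k
  have hharm := isLatticeHarmonicOn_edgeFun_of_isSHolAt (G := kcObs G₂ Λ η B cut) (c := c) (R := 2 * (2 * m)) hS i hi
  -- the `L²` bound for the `i`-th edge function alone
  set K : ℝ := 4 * Real.sqrt 2 * kcFluxConst * M * energyGradConst with hK
  have hK0 : 0 ≤ K := by
    have := kcFluxConst_pos; have := energyGradConst_pos; positivity
  have hL2i : ∑ y ∈ latticeBall c m, ‖edgeFun (kcObs G₂ Λ η B cut) i y‖ ^ 2 ≤ K * (m : ℕ) := by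
    refine le_trans (Finset.sum_le_sum fun y _ => ?_) (le_of_le_of_eq hL2 (by rw [hK]; ring))
    unfold edgeFun
    rcases hi with rfl | rfl
    · exact le_add_of_nonneg_right (sq_nonneg _)
    · exact le_add_of_nonneg_left (sq_nonneg _)
  have key := norm_le_of_harmonic_of_sum_sq_le (g := edgeFun (kcObs G₂ Λ η B cut) i) (a := a) hp hharm.1 hharm.2 hK0 hL2i hx
  simpa [edgeFun, kcSupConst, hK] using key

/-- **Lipschitz bound for the spin fermion in the bulk**: with `m = 8q`, `q ≥ 8`, under the bulk
hypotheses on the ball of radius `4m + 3` and `|Hw|, |Hb| ≤ M` on the ball of radius `4m + 1`,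
`‖F(x + e_j, ·) - F(x, ·)‖ ≤ 8 C_top C(M) / (2q √(2q))` for the edge functions at the sites of the
ball of radius `q`. [cite: ChelkakHonglerIzyurovAnnals2015, Thm 3.12 (equicontinuity (3.13))] -/
theorem norm_sub_kcObs_le_of_bulk {Hw Hb : Site 2 → ℝ} (h : IsKCPrimitive G₂ Λ criticalBetaTwo (.fixed η) B cut Hw Hb P)
    (hc : IsKCCuts G₂ Λ cut P) (hG : ∀ v ∈ Λ, ∀ k : Fin 4, G₂.Adj v (v + cornerUnit k)) (hle : G₂ ≤ zdGraph 2)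
    {a : Site 2} {q : ℕ} (hq : 8 ≤ q)
    (hbulk : KCBulk G₂ Λ B cut P (latticeBall (boxCentre a (4 * (2 * q))) (2 * (2 * (4 * (2 * q))) + 3)))
    {M : ℝ} (hM : 0 < M)
    (hHw : ∀ x ∈ latticeBall (boxCentre a (4 * (2 * q))) (2 * (2 * (4 * (2 * q))) + 1), |Hw x| ≤ M)
    (hHb : ∀ x ∈ latticeBall (boxCentre a (4 * (2 * q))) (2 * (2 * (4 * (2 * q))) + 1), |Hb x| ≤ M)
    {x : Site 2} (hx : x ∈ latticeBall (boxCentre a (4 * (2 * q))) q) {i : Fin 4} (hi : i = 0 ∨ i = 1) (j : Fin 4) :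
    ‖kcObs G₂ Λ η B cut (cSrc (x + cornerUnit j, i)) - kcObs G₂ Λ η B cut (cSrc (x, i))‖ ≤
      8 * topGradConst * (kcSupConst M / Real.sqrt (2 * q : ℕ)) / (2 * q : ℕ) := by
  set p := 2 * q with hp
  set m := 4 * p with hm
  set c := boxCentre a m with hc0
  have hp8 : 8 ≤ p := by omega
  have hsub : ∀ {R R' : ℤ}, R ≤ R' → ∀ y ∈ latticeBall c R, y ∈ latticeBall c R' :=
    fun hRR' y hy => latticeBall_subset hRR' hy
  have hsup : ∀ y ∈ latticeBall c p, ‖edgeFun (kcObs G₂ Λ η B cut) i y‖ ≤ kcSupConst M / Real.sqrt p := fun y hy =>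
    norm_kcObs_le_of_bulk h hc hG hle hp8 hbulk hM hHw hHb hy hi
  have hS : ∀ y ∈ latticeBall c (2 * (2 * m) + 2), ∀ k : Fin 4, IsSHolAt (kcObs G₂ Λ η B cut) (y, k) := by
    intro y hy k
    exact hbulk.isSHolAt_kcObs hc hG hle (hsub (by omega) y hy) (hsub (by omega) _ (add_cornerUnit_mem_latticeBall hy 2))
      (hsub (by omega) _ (add_cornerUnit_mem_latticeBall hy 3)) k
  have hharm := isLatticeHarmonicOn_edgeFun_of_isSHolAt (G := kcObs G₂ Λ η B cut) (c := c) (R := 2 * (2 * m)) hS i hi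
  have hM0 : 0 ≤ kcSupConst M / Real.sqrt p := div_nonneg (kcSupConst_nonneg M) (Real.sqrt_nonneg _)
  have key := norm_sub_le_of_harmonic_of_norm_le (g := edgeFun (kcObs G₂ Λ η B cut) i) (a := a) hq hharm.1 hharm.2 hM0
    (fun y hy => hsup y (by simpa [hp] using hy)) hx j
  simpa [edgeFun, hp] using key

end Literature.Probability.LatticeModels
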